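import Summits.HubbardSuperconductivity.HubbardSuperconductivity.Theorems.NodalDiracTwistTwistCalibrationBdGSpectrum

/-!
# Route `NodalDiracTwist` — support `TwistCalibrationBdG`: the overlap formula (holonomy, part 6)

For stmt-HubbardSuperconductivity-1625, second clause: the overlap of the BCS states `Vᴴ_φ e_{D↓}`
(the sector ground states of the `U = 0` sourced spin-twisted family off the degeneracy locus) at two
twists FACTORISES over momenta into the `ℝ²`-inner products of the lower Bogoliubov spinors,
`⟨Vᴴ_φ e_{D↓}, Vᴴ_{φ'} e_{D↓}⟩ = Π_x Re(conj p₋(z_{x̄}(φ)) · p₋(z_{x̄}(φ')))` (`star_bcs_dotProduct_bcs`):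
`W` is an isometry, `Γ` is multiplicative with `⟨S|Γ(g)|T⟩ = det g[S,T]` (tree, `FermionGammaFunctor`), so the
overlap is the `D↓ × D↓` minor of `U_φᴴ U_{φ'}`, which is diagonal
(`bdgModeMatrix_conjTranspose_mul_apply_down`).

Sources: Bardeen–Cooper–Schrieffer (1957) §II / de Gennes (1966) Ch. 5 (overlaps of BCS product states);
Bratteli–Robinson II §5.2.1. No definitions.
-/

-- the mandated namespace `Summit.<Summit>.<Problem>.Theorems` repeats `HubbardSuperconductivity`
-- (single-problem summit, D-0017), which the `dupNamespace` linter flags on every declaration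
set_option linter.dupNamespace false

namespace Summit.HubbardSuperconductivity.HubbardSuperconductivity.Theorems.NodalDiracTwist

open Matrix Finset Literature.Probability.LatticeModels Literature.MathematicalPhysics.QuantumLattice
open scoped ComplexConjugate

variable {d L : ℕ} [NeZero L]

/-! ## Part III (a): the overlap formula for the BCS states -/

section Overlap

/-- Lieb's transformation on the two-dimensional torus (local notation). -/
local notation "𝓦₂" => partialParticleHole (spinDownOrbitals : Finset (Orb (FermionTorus 2 L)))

/-- Entries of `U_φᴴ U_φ'` between lower-band labels: `⟨u_{(x,↓)}(φ), u_{(y,↓)}(φ')⟩ = δ_{xy}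
Re(conj p₋(z_{x̄}(φ)) · p₋(z_{x̄}(φ')))`. [folklore] -/
theorem bdgModeMatrix_conjTranspose_mul_apply_down (μ₀ h : ℝ) (φ φ' : Fin d → ℝ)
    (x y : FermionTorus d L) :
    ((bdgModeMatrix L μ₀ h φ)ᴴ * bdgModeMatrix L μ₀ h φ') (orb x 1) (orb y 1) =
      if x = y then ((((starRingEnd ℂ) (nambuLower (twistNambuZ L μ₀ h φ x.toTorusSite)) *
        nambuLower (twistNambuZ L μ₀ h φ' x.toTorusSite)).re : ℝ) : ℂ) else 0 := by
  rw [Matrix.mul_apply]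
  have : ∑ o, (bdgModeMatrix L μ₀ h φ)ᴴ (orb x 1) o * bdgModeMatrix L μ₀ h φ' o (orb y 1) =
      star (nambuMode L x.toTorusSite (bdgSpinor L μ₀ h φ x.toTorusSite 1)) ⬝ᵥ
        nambuMode L y.toTorusSite (bdgSpinor L μ₀ h φ' y.toTorusSite 1) := by
    rw [← bdgModeMatrix_col, ← bdgModeMatrix_col]
    rfl
  rw [this, star_nambuMode_dotProduct]
  have hinj : x.toTorusSite = y.toTorusSite ↔ x = y :=
    (FermionTorus.equivTorusSite (d := d) (L := L)).injective.eq_iff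
  simp only [hinj, bdgSpinor, one_ne_zero, if_false]
  by_cases hxy : x = y
  · subst hxy; rfl
  · rw [if_neg hxy, if_neg hxy]

omit [NeZero L] in
/-- `W (Wᴴ χ) = χ` on the torus. [folklore] -/
theorem partialParticleHole_mulVec_conjTranspose_mulVec (χ : Fock (Orb (FermionTorus 2 L))) :
    𝓦₂ *ᵥ (𝓦₂ᴴ *ᵥ χ) = χ := by
  have hW : 𝓦₂ * 𝓦₂ᴴ = 1 := by
    convert partialParticleHole_mul_conjTranspose (spinDownOrbitals : Finset (Orb (FermionTorus 2 L)))
  rw [mulVec_mulVec, hW, one_mulVec]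

/-- **The overlap formula.** The overlap of the BCS states `Vᴴ_φ e_{D↓}` at two twists is the product
over momenta of the `ℝ²`-inner products of the lower Bogoliubov spinors:
`⟨Vᴴ_φ e_{D↓}, Vᴴ_{φ'} e_{D↓}⟩ = Π_x Re(conj p₋(z_{x̄}(φ)) · p₋(z_{x̄}(φ')))` (`Γ` is the direct sum
of compound matrices, so the overlap is the `D↓ × D↓` minor of `U_φᴴ U_{φ'}`, which is diagonal).
Read (2009)/BCS folklore: overlaps of product states factorise. [folklore] -/
theorem star_bcs_dotProduct_bcs (μ₀ h : ℝ) (φ φ' : Fin 2 → ℝ) :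
    star ((bdgV L μ₀ h φ)ᴴ *ᵥ (Pi.single spinDownOrbitals 1 : Fock (Orb (FermionTorus 2 L)))) ⬝ᵥ
        ((bdgV L μ₀ h φ')ᴴ *ᵥ (Pi.single spinDownOrbitals 1 : Fock (Orb (FermionTorus 2 L)))) =
      ∏ x : FermionTorus 2 L, ((((starRingEnd ℂ) (nambuLower (twistNambuZ L μ₀ h φ x.toTorusSite)) *
        nambuLower (twistNambuZ L μ₀ h φ' x.toTorusSite)).re : ℝ) : ℂ) := by
  set s₀ : Finset (Orb (FermionTorus 2 L)) := spinDownOrbitals with hs₀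
  set U := bdgModeMatrix L μ₀ h φ with hU
  set U' := bdgModeMatrix L μ₀ h φ' with hU'
  -- remove `W`
  have h1 : star ((bdgV L μ₀ h φ)ᴴ *ᵥ (Pi.single s₀ 1 : Fock (Orb (FermionTorus 2 L)))) ⬝ᵥ
      ((bdgV L μ₀ h φ')ᴴ *ᵥ (Pi.single s₀ 1 : Fock (Orb (FermionTorus 2 L)))) =
      star (Gamma U *ᵥ (Pi.single s₀ 1 : Fock (Orb (FermionTorus 2 L)))) ⬝ᵥ
        (Gamma U' *ᵥ (Pi.single s₀ 1 : Fock (Orb (FermionTorus 2 L)))) := by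
    rw [bdgV, bdgV, conjTranspose_mul, conjTranspose_mul, conjTranspose_conjTranspose,
      conjTranspose_conjTranspose, ← mulVec_mulVec, ← mulVec_mulVec, RayleighBound.star_mulVec_dotProduct,
      conjTranspose_conjTranspose, partialParticleHole_mulVec_conjTranspose_mulVec]
  -- `⟨Γ(U) e, Γ(U') e⟩ = Γ(Uᴴ U')(s₀, s₀)`
  have h2 : star (Gamma U *ᵥ (Pi.single s₀ 1 : Fock (Orb (FermionTorus 2 L)))) ⬝ᵥ
      (Gamma U' *ᵥ (Pi.single s₀ 1 : Fock (Orb (FermionTorus 2 L)))) = Gamma (Uᴴ * U') s₀ s₀ := by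
    rw [RayleighBound.star_mulVec_dotProduct, ← Gamma_conjTranspose, mulVec_mulVec, ← Gamma_mul,
      star_single_one, single_dotProduct, one_mul, mulVec_single_one, Matrix.col_apply]
  -- the minor is the determinant of a diagonal matrix
  have h3 : Gamma (Uᴴ * U') s₀ s₀ = ∏ i : Fin s₀.card,
      (Uᴴ * U') (s₀.orderEmbOfFin rfl i) (s₀.orderEmbOfFin rfl i) := by
    rw [Gamma_apply_of_card_eq _ rfl rfl]
    have hdiag : (Uᴴ * U').submatrix (s₀.orderEmbOfFin rfl) (s₀.orderEmbOfFin rfl) =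
        diagonal fun i => (Uᴴ * U') (s₀.orderEmbOfFin rfl i) (s₀.orderEmbOfFin rfl i) := by
      ext i j
      rw [submatrix_apply, diagonal_apply]
      by_cases hij : i = j
      · subst hij; rw [if_pos rfl]
      · rw [if_neg hij]
        -- both labels are down-spin orbitals of distinct sites
        have hi := s₀.orderEmbOfFin_mem rfl i
        have hj := s₀.orderEmbOfFin_mem rfl j
        obtain ⟨⟨xi, σi⟩, hxi⟩ : ∃ q : FermionTorus 2 L × Fin 2, toLex q = s₀.orderEmbOfFin rfl i :=
          ⟨ofLex _, toLex_ofLex _⟩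
        obtain ⟨⟨xj, σj⟩, hxj⟩ : ∃ q : FermionTorus 2 L × Fin 2, toLex q = s₀.orderEmbOfFin rfl j :=
          ⟨ofLex _, toLex_ofLex _⟩
        rw [← hxi, hs₀] at hi
        rw [← hxj, hs₀] at hj
        change orb xi σi ∈ _ at hi
        change orb xj σj ∈ _ at hj
        rw [orb_mem_spinDownOrbitals_iff] at hi hj
        subst hi; subst hj
        rw [← hxi, ← hxj]
        change (Uᴴ * U') (orb xi 1) (orb xj 1) = 0
        rw [hU, hU', bdgModeMatrix_conjTranspose_mul_apply_down, if_neg]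
        intro hx
        apply hij
        apply (s₀.orderEmbOfFin rfl).injective
        rw [← hxi, ← hxj, hx]
    rw [hdiag, det_diagonal]
  -- reindex the product by sites
  have h4 : ∏ i : Fin s₀.card, (Uᴴ * U') (s₀.orderEmbOfFin rfl i) (s₀.orderEmbOfFin rfl i) =
      ∏ o ∈ s₀, (Uᴴ * U') o o := by
    refine Finset.prod_nbij (s₀.orderEmbOfFin rfl) (fun i _ => s₀.orderEmbOfFin_mem rfl i)
      (fun i _ j _ hij => (s₀.orderEmbOfFin rfl).injective hij) ?_ (fun i _ => rfl)
    intro o ho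
    have : o ∈ Set.range (s₀.orderEmbOfFin rfl) := by rw [Finset.range_orderEmbOfFin]; exact ho
    obtain ⟨i, hi⟩ := this
    exact ⟨i, Finset.mem_coe.mpr (Finset.mem_univ _), hi⟩
  have h5 : ∏ o ∈ s₀, (Uᴴ * U') o o = ∏ x : FermionTorus 2 L, (Uᴴ * U') (orb x 1) (orb x 1) := by
    have himg : s₀ = Finset.univ.image fun x : FermionTorus 2 L => orb x 1 := by
      ext o
      obtain ⟨⟨x, σ⟩, rfl⟩ : ∃ q : FermionTorus 2 L × Fin 2, toLex q = o := ⟨ofLex o, toLex_ofLex o⟩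
      change orb x σ ∈ _ ↔ orb x σ ∈ _
      rw [hs₀, orb_mem_spinDownOrbitals_iff, Finset.mem_image]
      constructor
      · rintro rfl; exact ⟨x, Finset.mem_univ _, rfl⟩
      · rintro ⟨y, -, hy⟩; exact (orb_eq_orb_iff.mp hy).2.symm
    rw [himg, Finset.prod_image (fun x _ y _ hxy => (orb_eq_orb_iff.mp hxy).1)]
  rw [h1, h2, h3, h4, h5]
  refine Finset.prod_congr rfl fun x _ => ?_
  rw [hU, hU', bdgModeMatrix_conjTranspose_mul_apply_down, if_pos rfl]

end Overlap

end Summit.HubbardSuperconductivity.HubbardSuperconductivity.Theorems.NodalDiracTwist
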